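import Summits.QuantumFields.YangMills.Theorems.BalabanUVNodesN15CurvedGluingLocalGauges
import Summits.QuantumFields.YangMills.Theorems.BalabanUVNodesN15CurvedGluingCubeDefectGluingClose
import HarnessLib

/-!
# N15 = NE2, road (c) — PROGRAMME (PC), towards (PC-B): WALK LOCALITY OF FILE 46's GLUED OPERATOR FROM PER-CUBE-GAUGE PARAMETRICES — two families of cube data in per-cube gauges, the
# SAME gauges and ε-close data (cut rows, commutator rows, defects, all in the cube's gauge) on the cubes NOT `Far` ⟹ the glued operators differ by `[C_nearε + C_far e^{−(δ∕4−σ)d_Z(y)}]e^{−(δ∕4−2σ)d}`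
# (n15-c∕291 conjugated back cube by cube; dag-n15-c g27, n15-c∕292)

Cell `pub-ymgap`, seat `pub-ymgap-dag-n15-c` (generation g27; R134 (a), s1; HUMAN RULING D-0062).  `bears_on: R4∕N15 · K3⁸ SpineGivenEndpointR13SepCoPHV (stmt-QuantumFields-27366)`;
filed `--kind proof --supports stmt-QuantumFields-27366 --as helper` — COUNT-NEUTRAL.  Pure block-majorant algebra; 0 `def`, 0 `sorry`.  Imports FILE 46 `…CurvedGluingLocalGauges`
(`cutRow_of_localGauge`, `commRow_of_localGauge`, `defectRow_of_localGauge`, `localOp_conj_back`; g4 `commOp_comp_gaugeConj`, `mulOp_comp_gaugeConj`, `hasMaj_gaugeConj_back`) and n15-c∕291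
`…CurvedGluingCubeDefectGluingClose` (`hasMaj_glued_sub_glued_of_cutRows_defect_close`).  Nothing in the tree is modified.

WHAT.  `cutRow_sub_of_localGauge`, `commRow_sub_of_localGauge`, `defectRow_sub_of_localGauge` (the three closeness rows conjugate back with `|κ|²`, same gauge on both families); ★★★
`hasMaj_glued_sub_glued_of_localGauges_close`: FILE 46 `hasMaj_glued_of_localGauges`' hypotheses for two data sets `(W, Δ, G′, E′)`, `(W♭, Δ♭, G♭, E♭)` over the same partition, cuts,
reaches and overlap, `W♭_□ = W_□` and the data ε-close IN THE CUBE's GAUGE on the cubes not `Far`, `S_□ ⊆ Z` on the far cubes, `8σ ≤ δ` ⟹ the two glued operators differ by n15-c∕291's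
majorant with `β, θ₀, ε, ε_G, ε_K, ε_E` multiplied by `|κ|²`.

HONEST FRAMING ∕ LIMITS.  Algebra of glued inverses; no propagator estimated; [B9] (3.34)–(3.35) p.396, Cor. 3.8 ∕ Thm 3.14 cited for SHAPES ∕ MECHANISM.  NE2⁺ NOT PRINTED, NOT proved;
N15 of record untouched; K3⁸ OPEN; counts UNMOVED.  Restate-immune (no Theses import).
-/

set_option autoImplicit false

noncomputable section
open scoped BigOperators Matrix
open Finset

namespace Summit.QuantumFields.YangMills.BalabanUVNodes.N15.CurvedSpecies

open Literature.MathematicalPhysics.QuantumFieldTheory.Balaban1983to89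
open Literature.MathematicalPhysics.QuantumFieldTheory.Balaban1983to89.B11SectG (BlockNorm HasMaj RowSum)
open Literature.MathematicalPhysics.QuantumFieldTheory.Balaban1983to89.B6RandomWalk (Triangle254)
open Literature.MathematicalPhysics.QuantumFieldTheory.Balaban1983to89.B6Prop26Gluing (mulOp ind ind_nonneg)
open Summit.QuantumFields.YangMills.BalabanUVNodes.N15.MatrixSpecies (mmulOp liftBlk)
open Summit.QuantumFields.YangMills.BalabanUVNodes.N15.Gluing (parametrix remainder commOp glueInv)

variable {X : Type} [Fintype X] [DecidableEq X] {κ : Type} [Fintype κ] [DecidableEq κ] {K : Type} [Fintype K] {g : B6.Geometry} (blk : X → g.Site) (S : K → Set g.Site)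
  (W : K → X → Matrix κ κ ℝ) (Δ Δ' : (X × κ → ℝ) →ₗ[ℝ] (X × κ → ℝ)) (hX χX : K → X → ℝ) (G' G'' E' E'' : K → (X × κ → ℝ) →ₗ[ℝ] (X × κ → ℝ))

/-! ## §1 Closeness rows conjugate back -/

section Rows

omit [DecidableEq X] [Fintype K] in
/-- cut rows of a DIFFERENCE conjugate back: `M_χ(G′ − G″) ≤ 1_S1_S·εe^{−δd}` ⟹ `M_χ(M_{Wᵀ}G′M_W − M_{Wᵀ}G″M_W) ≤ 1_S1_S·|κ|²ε·e^{−δd}`. [cite: Balaban1985BackgroundPropagators, (3.34)–(3.35) p.396 (shapes)] -/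
theorem cutRow_sub_of_localGauge (hW : ∀ k x, W k x * (W k x)ᵀ = 1) (hW' : ∀ k x, (W k x)ᵀ * W k x = 1) {ε δ : ℝ} (hε : 0 ≤ ε) (k : K)
    (h : HasMaj (BlockNorm.ofBlocks g (liftBlk blk κ)) (BlockNorm.ofBlocks g (liftBlk blk κ)) (mulOp (fun p : X × κ => χX k p.1) ∘ₗ (G' k - G'' k))
      (fun y y' => ind (S k) y * ind (S k) y' * (ε * Real.exp (-(δ * g.dist y y'))))) :
    HasMaj (BlockNorm.ofBlocks g (liftBlk blk κ)) (BlockNorm.ofBlocks g (liftBlk blk κ))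
      (mulOp (fun p : X × κ => χX k p.1) ∘ₗ ((mmulOp (fun x => (W k x)ᵀ) ∘ₗ G' k ∘ₗ mmulOp (W k)) - (mmulOp (fun x => (W k x)ᵀ) ∘ₗ G'' k ∘ₗ mmulOp (W k))))
      (fun y y' => ind (S k) y * ind (S k) y' * ((Fintype.card κ : ℝ) ^ 2 * ε * Real.exp (-(δ * g.dist y y')))) := by
  have e : (mmulOp (fun x => (W k x)ᵀ) ∘ₗ G' k ∘ₗ mmulOp (W k)) - (mmulOp (fun x => (W k x)ᵀ) ∘ₗ G'' k ∘ₗ mmulOp (W k)) =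
      mmulOp (fun x => (W k x)ᵀ) ∘ₗ (fun k => G' k - G'' k) k ∘ₗ mmulOp (W k) := by
    simp only [LinearMap.sub_comp, LinearMap.comp_sub]
  rw [e]
  exact cutRow_of_localGauge blk S W χX (fun k => G' k - G'' k) hW hW' hε k h

omit [DecidableEq X] [Fintype K] in
/-- commutator rows of a DIFFERENCE (two operators, one gauge) conjugate back: `[Δ^W,M_h]G′ − [Δ♭^W,M_h]G″ ≤ 1_S(y′)·εe^{−δd}` ⟹ `[Δ,M_h](M_{Wᵀ}G′M_W) − [Δ♭,M_h](M_{Wᵀ}G″M_W) ≤ 1_S(y′)·|κ|²ε·e^{−δd}`.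
[cite: Balaban1984PropagatorsII, (2.93) p.239 (shape); Balaban1985BackgroundPropagators, (3.34) p.396] -/
theorem commRow_sub_of_localGauge (hW : ∀ k x, W k x * (W k x)ᵀ = 1) (hW' : ∀ k x, (W k x)ᵀ * W k x = 1) {ε δ : ℝ} (hε : 0 ≤ ε) (k : K)
    (h : HasMaj (BlockNorm.ofBlocks g (liftBlk blk κ)) (BlockNorm.ofBlocks g (liftBlk blk κ))
      (commOp (mmulOp (W k) ∘ₗ Δ ∘ₗ mmulOp (fun x => (W k x)ᵀ)) (fun p : X × κ => hX k p.1) ∘ₗ G' k -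
        commOp (mmulOp (W k) ∘ₗ Δ' ∘ₗ mmulOp (fun x => (W k x)ᵀ)) (fun p : X × κ => hX k p.1) ∘ₗ G'' k)
      (fun y y' => ind (S k) y' * (ε * Real.exp (-(δ * g.dist y y'))))) :
    HasMaj (BlockNorm.ofBlocks g (liftBlk blk κ)) (BlockNorm.ofBlocks g (liftBlk blk κ))
      (commOp Δ (fun p : X × κ => hX k p.1) ∘ₗ (mmulOp (fun x => (W k x)ᵀ) ∘ₗ G' k ∘ₗ mmulOp (W k)) -
        commOp Δ' (fun p : X × κ => hX k p.1) ∘ₗ (mmulOp (fun x => (W k x)ᵀ) ∘ₗ G'' k ∘ₗ mmulOp (W k)))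
      (fun y y' => ind (S k) y' * ((Fintype.card κ : ℝ) ^ 2 * ε * Real.exp (-(δ * g.dist y y')))) := by
  have hV' : ∀ x, ((W k x)ᵀ)ᵀ * (W k x)ᵀ = 1 := fun x => by rw [Matrix.transpose_transpose]; exact hW k x
  have e1 := commOp_comp_gaugeConj (fun x => (W k x)ᵀ) hV' (hX k) (mmulOp (W k) ∘ₗ Δ ∘ₗ mmulOp (fun x => (W k x)ᵀ)) (G' k)
  have e2 := commOp_comp_gaugeConj (fun x => (W k x)ᵀ) hV' (hX k) (mmulOp (W k) ∘ₗ Δ' ∘ₗ mmulOp (fun x => (W k x)ᵀ)) (G'' k)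
  simp only [Matrix.transpose_transpose] at e1 e2
  rw [show (fun x => W k x) = W k from rfl, localOp_conj_back W Δ hW' k] at e1
  rw [show (fun x => W k x) = W k from rfl, localOp_conj_back W Δ' hW' k] at e2
  rw [e1, e2, ← LinearMap.comp_sub, ← LinearMap.sub_comp]
  refine (hasMaj_gaugeConj_back blk (W k) (hW k) (hW' k) (fun y y' => ?_) h).mono fun y y' => le_of_eq (by ring)
  exact mul_nonneg (ind_nonneg _ y') (mul_nonneg hε (Real.exp_nonneg _))

omit [DecidableEq X] [Fintype K] in
/-- defect rows of a DIFFERENCE conjugate back. [cite: Balaban1985BackgroundPropagators, (3.34)–(3.35) p.396 (shapes)] -/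
theorem defectRow_sub_of_localGauge (hW : ∀ k x, W k x * (W k x)ᵀ = 1) (hW' : ∀ k x, (W k x)ᵀ * W k x = 1) {ε δ : ℝ} (hε : 0 ≤ ε) (k : K)
    (h : HasMaj (BlockNorm.ofBlocks g (liftBlk blk κ)) (BlockNorm.ofBlocks g (liftBlk blk κ)) (E' k - E'' k) (fun y y' => ind (S k) y * (ε * Real.exp (-(δ * g.dist y y'))))) :
    HasMaj (BlockNorm.ofBlocks g (liftBlk blk κ)) (BlockNorm.ofBlocks g (liftBlk blk κ))
      ((mmulOp (fun x => (W k x)ᵀ) ∘ₗ E' k ∘ₗ mmulOp (W k)) - (mmulOp (fun x => (W k x)ᵀ) ∘ₗ E'' k ∘ₗ mmulOp (W k)))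
      (fun y y' => ind (S k) y * ((Fintype.card κ : ℝ) ^ 2 * ε * Real.exp (-(δ * g.dist y y')))) := by
  rw [← LinearMap.comp_sub, ← LinearMap.sub_comp]
  refine (hasMaj_gaugeConj_back blk (W k) (hW k) (hW' k) (fun y y' => ?_) h).mono fun y y' => le_of_eq (by ring)
  exact mul_nonneg (ind_nonneg _ y) (mul_nonneg hε (Real.exp_nonneg _))

end Rows

/-! ## §2 The glued operators of two per-cube-gauge families with close near data -/

section Glue

variable (W' : K → X → Matrix κ κ ℝ) (Far : K → Prop) [DecidablePred Far] (Z : Set g.Site) (dZ : g.Site → ℝ) {σ cr : ℝ}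

/-- ★★★ **WALK LOCALITY OF THE GLUED OPERATOR FROM PER-CUBE-GAUGE PARAMETRICES, CLOSE NEAR DATA** — FILE 46's `hasMaj_glued_of_localGauges` for two data sets over the same partition,
cuts, reaches, overlap and smallness `N_ov|κ|²(θ₀ + ε)c_r < 1`; on the cubes not `Far` the gauges AGREE and the data are ε-close in the cube's gauge; `S_□ ⊆ Z` on the far cubes; `8σ ≤ δ`
⟹ n15-c∕291's majorant with every letter multiplied by `|κ|²`. [cite: Balaban1985BackgroundPropagators, (3.34)–(3.35) p.396, Cor. 3.8 p.410, Thm 3.14 pp.426–427 (mechanism); Balaban1984PropagatorsII, (2.91) p.239, (2.133)–(2.136) p.247] -/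
theorem hasMaj_glued_sub_glued_of_localGauges_close (htri : Triangle254 g) (hd : ∀ a b : g.Site, 0 ≤ g.dist a b) (hd0 : ∀ y : g.Site, g.dist y y = 0) (hrow : RowSum g σ cr)
    (hσ : 0 ≤ σ) (hcr : 0 ≤ cr) (hdZ : ∀ y z, z ∈ Z → dZ y ≤ g.dist y z) (hdZ0 : ∀ y, 0 ≤ dZ y)
    (hW : ∀ k x, W k x * (W k x)ᵀ = 1) (hW'' : ∀ k x, (W k x)ᵀ * W k x = 1) (hV : ∀ k x, W' k x * (W' k x)ᵀ = 1) (hV' : ∀ k x, (W' k x)ᵀ * W' k x = 1)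
    {β θ₀ ε εG εK εE δ Nov : ℝ} (hβ : 0 ≤ β) (hθ : 0 ≤ θ₀) (hε : 0 ≤ ε) (hεG : 0 ≤ εG) (hεK : 0 ≤ εK) (hεE : 0 ≤ εE) (hNov : 0 ≤ Nov) (hσδ : 8 * σ ≤ δ)
    (hcut : ∀ k, mulOp (fun p : X × κ => hX k p.1) ∘ₗ mulOp (fun p : X × κ => χX k p.1) = mulOp (fun p : X × κ => hX k p.1)) (hh : ∀ k p, |(fun p : X × κ => hX k p.1) p| ≤ 1)
    (hN : ∀ a, ∑ k, ind (S k) a ≤ Nov) (hZ : ∀ k, Far k → S k ⊆ Z) (hWW : ∀ k, ¬Far k → W' k = W k)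
    (hGc' : ∀ k, HasMaj (BlockNorm.ofBlocks g (liftBlk blk κ)) (BlockNorm.ofBlocks g (liftBlk blk κ)) (mulOp (fun p : X × κ => χX k p.1) ∘ₗ G' k)
      (fun y y' => ind (S k) y * ind (S k) y' * (β * Real.exp (-(δ * g.dist y y')))))
    (hGc'' : ∀ k, HasMaj (BlockNorm.ofBlocks g (liftBlk blk κ)) (BlockNorm.ofBlocks g (liftBlk blk κ)) (mulOp (fun p : X × κ => χX k p.1) ∘ₗ G'' k)
      (fun y y' => ind (S k) y * ind (S k) y' * (β * Real.exp (-(δ * g.dist y y')))))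
    (hK' : ∀ k, HasMaj (BlockNorm.ofBlocks g (liftBlk blk κ)) (BlockNorm.ofBlocks g (liftBlk blk κ))
      (commOp (mmulOp (W k) ∘ₗ Δ ∘ₗ mmulOp (fun x => (W k x)ᵀ)) (fun p : X × κ => hX k p.1) ∘ₗ G' k) (fun y y' => ind (S k) y' * (θ₀ * Real.exp (-(δ * g.dist y y')))))
    (hK'' : ∀ k, HasMaj (BlockNorm.ofBlocks g (liftBlk blk κ)) (BlockNorm.ofBlocks g (liftBlk blk κ))
      (commOp (mmulOp (W' k) ∘ₗ Δ' ∘ₗ mmulOp (fun x => (W' k x)ᵀ)) (fun p : X × κ => hX k p.1) ∘ₗ G'' k) (fun y y' => ind (S k) y' * (θ₀ * Real.exp (-(δ * g.dist y y')))))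
    (hE' : ∀ k, HasMaj (BlockNorm.ofBlocks g (liftBlk blk κ)) (BlockNorm.ofBlocks g (liftBlk blk κ)) (E' k) (fun y y' => ind (S k) y * (ε * Real.exp (-(δ * g.dist y y')))))
    (hE'' : ∀ k, HasMaj (BlockNorm.ofBlocks g (liftBlk blk κ)) (BlockNorm.ofBlocks g (liftBlk blk κ)) (E'' k) (fun y y' => ind (S k) y * (ε * Real.exp (-(δ * g.dist y y')))))
    (hGG : ∀ k, ¬Far k → HasMaj (BlockNorm.ofBlocks g (liftBlk blk κ)) (BlockNorm.ofBlocks g (liftBlk blk κ)) (mulOp (fun p : X × κ => χX k p.1) ∘ₗ (G' k - G'' k))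
      (fun y y' => ind (S k) y * ind (S k) y' * (εG * Real.exp (-(δ * g.dist y y')))))
    (hKK : ∀ k, ¬Far k → HasMaj (BlockNorm.ofBlocks g (liftBlk blk κ)) (BlockNorm.ofBlocks g (liftBlk blk κ))
      (commOp (mmulOp (W k) ∘ₗ Δ ∘ₗ mmulOp (fun x => (W k x)ᵀ)) (fun p : X × κ => hX k p.1) ∘ₗ G' k -
        commOp (mmulOp (W k) ∘ₗ Δ' ∘ₗ mmulOp (fun x => (W k x)ᵀ)) (fun p : X × κ => hX k p.1) ∘ₗ G'' k) (fun y y' => ind (S k) y' * (εK * Real.exp (-(δ * g.dist y y')))))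
    (hEE : ∀ k, ¬Far k → HasMaj (BlockNorm.ofBlocks g (liftBlk blk κ)) (BlockNorm.ofBlocks g (liftBlk blk κ)) (E' k - E'' k) (fun y y' => ind (S k) y * (εE * Real.exp (-(δ * g.dist y y')))))
    (hq : Nov * ((Fintype.card κ : ℝ) ^ 2 * θ₀ + (Fintype.card κ : ℝ) ^ 2 * ε) * cr < 1) :
    HasMaj (BlockNorm.ofBlocks g (liftBlk blk κ)) (BlockNorm.ofBlocks g (liftBlk blk κ))
      (glueInv (parametrix (fun k => fun p : X × κ => hX k p.1) (fun k => mmulOp (fun x => (W k x)ᵀ) ∘ₗ G' k ∘ₗ mmulOp (W k)))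
          (remainder Δ (fun k => fun p : X × κ => hX k p.1) (fun k => mmulOp (fun x => (W k x)ᵀ) ∘ₗ G' k ∘ₗ mmulOp (W k)) -
            ∑ k, (mmulOp (fun x => (W k x)ᵀ) ∘ₗ E' k ∘ₗ mmulOp (W k)) ∘ₗ mulOp (fun p : X × κ => hX k p.1)) -
        glueInv (parametrix (fun k => fun p : X × κ => hX k p.1) (fun k => mmulOp (fun x => (W' k x)ᵀ) ∘ₗ G'' k ∘ₗ mmulOp (W' k)))
          (remainder Δ' (fun k => fun p : X × κ => hX k p.1) (fun k => mmulOp (fun x => (W' k x)ᵀ) ∘ₗ G'' k ∘ₗ mmulOp (W' k)) -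
            ∑ k, (mmulOp (fun x => (W' k x)ᵀ) ∘ₗ E'' k ∘ₗ mmulOp (W' k)) ∘ₗ mulOp (fun p : X × κ => hX k p.1)))
      (fun y y' => ((Nov * ((Fintype.card κ : ℝ) ^ 2 * εG) + Nov * ((Fintype.card κ : ℝ) ^ 2 * β) * ((1 - Nov * ((Fintype.card κ : ℝ) ^ 2 * θ₀ + (Fintype.card κ : ℝ) ^ 2 * ε) * cr)⁻¹ * cr) *
            (Nov * ((Fintype.card κ : ℝ) ^ 2 * εK + (Fintype.card κ : ℝ) ^ 2 * εE)) * cr) * ((1 - Nov * ((Fintype.card κ : ℝ) ^ 2 * θ₀ + (Fintype.card κ : ℝ) ^ 2 * ε) * cr)⁻¹ * cr) +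
          (Nov * (2 * ((Fintype.card κ : ℝ) ^ 2 * β)) + Nov * ((Fintype.card κ : ℝ) ^ 2 * β) * ((1 - Nov * ((Fintype.card κ : ℝ) ^ 2 * θ₀ + (Fintype.card κ : ℝ) ^ 2 * ε) * cr)⁻¹ * cr) *
            (Nov * (2 * ((Fintype.card κ : ℝ) ^ 2 * ε)) + Nov * (2 * ((Fintype.card κ : ℝ) ^ 2 * θ₀))) * cr) *
            ((1 - Nov * ((Fintype.card κ : ℝ) ^ 2 * θ₀ + (Fintype.card κ : ℝ) ^ 2 * ε) * cr)⁻¹ * cr) * Real.exp (-((δ / 4 - σ) * dZ y))) *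
        Real.exp (-((δ / 4 - 2 * σ) * g.dist y y'))) := by
  refine hasMaj_glued_sub_glued_of_cutRows_defect_close (liftBlk blk κ) S Far Z dZ htri hd hd0 hrow hσ hcr hdZ hdZ0 (by positivity) (by positivity) (by positivity) (by positivity)
    (by positivity) (by positivity) hNov hσδ hcut hh hN hZ (fun k => cutRow_of_localGauge blk S W χX G' hW hW'' hβ k (hGc' k))
    (fun k => cutRow_of_localGauge blk S W' χX G'' hV hV' hβ k (hGc'' k)) (fun k => commRow_of_localGauge blk S W Δ hX G' hW hW'' hθ k (hK' k))
    (fun k => commRow_of_localGauge blk S W' Δ' hX G'' hV hV' hθ k (hK'' k)) (fun k => defectRow_of_localGauge blk S W E' hW hW'' hε k (hE' k))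
    (fun k => defectRow_of_localGauge blk S W' E'' hV hV' hε k (hE'' k)) (fun k hk => ?_) (fun k hk => ?_) (fun k hk => ?_) hq
  · rw [hWW k hk]; exact cutRow_sub_of_localGauge blk S W χX G' G'' hW hW'' hεG k (hGG k hk)
  · rw [hWW k hk]; exact commRow_sub_of_localGauge blk S W Δ Δ' hX G' G'' hW hW'' hεK k (hKK k hk)
  · rw [hWW k hk]; exact defectRow_sub_of_localGauge blk S W E' E'' hW hW'' hεE k (hEE k hk)

end Glue

end Summit.QuantumFields.YangMills.BalabanUVNodes.N15.CurvedSpecies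

end
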